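import Summits.HodgeConjecture.HodgeConjecture.Theorems.MarkmanPartnerTransportPartnerExistenceLatticeTransc
import Summits.HodgeConjecture.HodgeConjecture.Theorems.MarkmanPartnerTransportPartnerExistenceSignatureReal

/-!
# Route MarkmanPartnerTransport · support `PartnerExistence` (stmt-HodgeConjecture-19655) —
# Hodge index on the real transcendental space `T_ℚ ⊗ ℝ` of a marked `K3^{[2]}`-type fourfold

For a marked smooth projective fourfold `(X, φ, P, z)` with rational transcendental space `T_ℚ ⊂ ℚ²³`
(`…PartnerExistenceLattice`): **a non-zero REAL transcendental vector `w ∈ T_ℚ ⊗ ℝ ⊂ ℝ²³` that is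
`q`-orthogonal to the real and imaginary parts of the period `z` has `q(w, w) < 0`.**  Indeed `φ⁻¹ w` is a
real class (real coordinates), `q`-orthogonal to `N¹(X)` (`mem_span_ratTransc_iff`), and `⊥ z, z̄`, i.e. of
type `(1,1)` (m5); it is `q`-orthogonal to the Kähler class `κ ∈ N¹(X)` of a Kähler–rational datum, so
the Hodge index inequality `BBFPositivity.k3HilbertForm_self_neg_of_oneOne_of_kaehler_orthogonal`
applies.  Together with the positive `2`-plane `⟨Re z, Im z⟩ ⊂ T_ℚ ⊗ ℝ` this says `T(X)_ℝ` has signature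
`(2, 21 − ρ)`; it is the hypothesis `hneg` of `PartnerExistenceSignature.exists_pos_mem_orthogonal`
(after transport to `Λ_{K3} ⊗ ℝ` by the Hasse–Minkowski embedding).

* `realCast_mem_span_ratTransc` — `T_ℚ ⊗ ℝ ⊂ T_ℚ ⊗ ℂ` (coordinatewise);
* `k3HilbertForm_realCast_period`, `k3HilbertForm_realCast_star_period` — `q(w, z) = q(w, Re z) + i q(w, Im z)`, etc.;
* `qR_self_neg_of_mem_span_ratTransc` — the statement above.

No definition, no sorry, no named fact. Prover seat hodge-nonav-19652-p1 (gen 5), `--supports stmt-HodgeConjecture-19655`.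

References: A. Beauville, J. Differential Geom. 18 (1983) §8 Thm. 5; C. Voisin, *Hodge Theory I*, §6.3.2
Thm. 6.32; D. Huybrechts, *Lectures on K3 Surfaces*, Ch. 3 Lemma 3.1 and Ch. 6 Prop. 1.2.
-/

noncomputable section

set_option linter.dupNamespace false

open Module CategoryTheory
open Literature.AlgebraicTopology.SingularHomology Literature.Geometry.Kaehler
open Literature.AlgebraicGeometry Literature.AlgebraicGeometry.Motives Literature.AlgebraicGeometry.HodgeTheory
open Literature.AlgebraicGeometry.Hyperkaehler Literature.AlgebraicGeometry.Surfaces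
open Summit.HodgeConjecture.HodgeConjecture.Theorems.NikulinTwinTransport
open Summit.HodgeConjecture.HodgeConjecture.Theorems.AnchorExistenceCMFloor
open Summit.HodgeConjecture.HodgeConjecture.Theorems.MarkmanPartnerTransport.BBFPositivity
open Summit.HodgeConjecture.HodgeConjecture.Theorems.MarkmanPartnerTransport.PartnerExistenceSignature

namespace Summit.HodgeConjecture.HodgeConjecture.Theorems.MarkmanPartnerTransport.PartnerLattice

variable {X : SchemeOver ℂ}

/-- `MarkedK3Sq[X, φ, P, z]`: VERBATIM the `let MarkedK3Sq := …` binder of the route declarations of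
MarkmanPartnerTransport (clauses (m1)–(m6)). Local notation only. -/
local notation3 (prettyPrint := false) "MarkedK3Sq[" X ", " φ ", " P ", " z "]" =>
  (((IsIntegralClass P ∧ ∀ Q : complexBetti X (2 * 4), IsIntegralClass Q → ∃ n : ℤ, Q = n • P) ∧
    (∀ c : complexBetti X 2, IsIntegralClass c ↔ ∃ v : K3HilbertIndex → ℤ, φ c = fun i => (v i : ℂ)) ∧
    (∀ a : complexBetti X 2, cupPowTwo a 4 = ((3 : ℂ) * (k3HilbertForm 2 (φ a) (φ a)) ^ 2) • P) ∧
    (IsOfHodgeType 4 X 2 2 0 (LinearEquiv.symm φ z) ∧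
      ∀ τ : complexBetti X 2, IsOfHodgeType 4 X 2 2 0 τ → ∃ t : ℂ, τ = t • LinearEquiv.symm φ z) ∧
    (∀ c : complexBetti X 2, IsOfHodgeType 4 X 2 1 1 c ↔
      (k3HilbertForm 2 (φ c) z = 0 ∧ k3HilbertForm 2 (φ c) (star z) = 0)) ∧
    (k3HilbertForm 2 z z = 0 ∧ 0 < (k3HilbertForm 2 (star z) z).re)))

/-- `qQ` = the rational Beauville–Bogomolov form of `K3^{[2]}`-type on `ℚ²³`. Local notation only. -/
local notation3 (prettyPrint := false) "qQ" => Matrix.toBilin' (Matrix.map (k3HilbertGram 2) (Int.cast : ℤ → ℚ))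

/-- `qR` = the real Beauville–Bogomolov form of `K3^{[2]}`-type on `ℝ²³`. Local notation only. -/
local notation3 (prettyPrint := false) "qR" => Matrix.toBilin' (Matrix.map (k3HilbertGram 2) (Int.cast : ℤ → ℝ))

/-! ### Real vectors of `T_ℚ ⊗ ℝ` are complex vectors of `T_ℚ ⊗ ℂ` -/

/-- **`T_ℚ ⊗ ℝ ⊂ T_ℚ ⊗ ℂ`**: the complexification of a real combination of rational vectors of a
`ℚ`-subspace `R` is a complex combination of them. [folklore] -/
theorem realCast_mem_span_ratCast {ι : Type*} (R : Submodule ℚ (ι → ℚ)) {w : ι → ℝ}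
    (hw : w ∈ Submodule.span ℝ ((fun a : ι → ℚ => fun i => (a i : ℝ)) '' (R : Set (ι → ℚ)))) :
    (fun i => ((w i : ℝ) : ℂ)) ∈ Submodule.span ℂ ((fun a : ι → ℚ => fun i => (a i : ℂ)) '' (R : Set (ι → ℚ))) := by
  induction hw using Submodule.span_induction with
  | mem x hx =>
    obtain ⟨a, ha, rfl⟩ := hx
    have h : (fun i => (((fun a : ι → ℚ => fun i => (a i : ℝ)) a i : ℝ) : ℂ)) = fun i => (a i : ℂ) := by
      funext i
      simp only [Complex.ofReal_ratCast]
    rw [h]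
    exact Submodule.subset_span ⟨a, ha, rfl⟩
  | zero =>
    have h : (fun i => (((0 : ι → ℝ) i : ℝ) : ℂ)) = 0 := by funext i; simp
    rw [h]
    exact Submodule.zero_mem _
  | add x y _ _ hx hy =>
    have h : (fun i => (((x + y) i : ℝ) : ℂ)) = (fun i => ((x i : ℝ) : ℂ)) + fun i => ((y i : ℝ) : ℂ) := by
      funext i; simp
    rw [h]
    exact Submodule.add_mem _ hx hy
  | smul r x _ hx =>
    have h : (fun i => (((r • x) i : ℝ) : ℂ)) = (r : ℂ) • fun i => ((x i : ℝ) : ℂ) := by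
      funext i; simp
    rw [h]
    exact Submodule.smul_mem _ _ hx

/-! ### `q(w, z)` and `q(w, z̄)` in terms of the real and imaginary parts of `z` -/

/-- `z = Re z + i Im z` coordinatewise. [folklore] -/
theorem period_eq_re_add_im (z : K3HilbertIndex → ℂ) :
    z = (fun i => ((z i).re : ℂ)) + Complex.I • fun i => ((z i).im : ℂ) := by
  funext i
  simp only [Pi.add_apply, Pi.smul_apply, smul_eq_mul]
  rw [mul_comm, Complex.re_add_im]

/-- `z̄ = Re z − i Im z` coordinatewise. [folklore] -/
theorem star_period_eq_re_sub_im (z : K3HilbertIndex → ℂ) :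
    star z = (fun i => ((z i).re : ℂ)) - Complex.I • fun i => ((z i).im : ℂ) := by
  funext i
  apply Complex.ext <;> simp

/-- **`q(w, z) = q(w, Re z) + i q(w, Im z)`** for a real vector `w`. [folklore] -/
theorem k3HilbertForm_realCast_period (w : K3HilbertIndex → ℝ) (z : K3HilbertIndex → ℂ) :
    k3HilbertForm 2 (fun i => ((w i : ℝ) : ℂ)) z =
      ((qR w (fun i => (z i).re) : ℝ) : ℂ) + Complex.I * ((qR w (fun i => (z i).im) : ℝ) : ℂ) := by
  conv_lhs => rw [period_eq_re_add_im z]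
  rw [k3HilbertForm_add_right, k3HilbertForm_smul_right, k3HilbertForm_realCast, k3HilbertForm_realCast]

/-- **`q(w, z̄) = q(w, Re z) − i q(w, Im z)`** for a real vector `w`. [folklore] -/
theorem k3HilbertForm_realCast_star_period (w : K3HilbertIndex → ℝ) (z : K3HilbertIndex → ℂ) :
    k3HilbertForm 2 (fun i => ((w i : ℝ) : ℂ)) (star z) =
      ((qR w (fun i => (z i).re) : ℝ) : ℂ) - Complex.I * ((qR w (fun i => (z i).im) : ℝ) : ℂ) := by
  rw [star_period_eq_re_sub_im z, sub_eq_add_neg, ← neg_smul, k3HilbertForm_add_right,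
    k3HilbertForm_smul_right, k3HilbertForm_realCast, k3HilbertForm_realCast]
  ring

/-! ### Hodge index on `T_ℚ ⊗ ℝ` -/

section NS

variable {φ : complexBetti X 2 ≃ₗ[ℂ] (K3HilbertIndex → ℂ)} {P : complexBetti X (2 * 4)} {z : K3HilbertIndex → ℂ}
  {NQ : Submodule ℚ (K3HilbertIndex → ℚ)}

/-- **Hodge index on the real transcendental space.**  A non-zero real vector `w ∈ T_ℚ ⊗ ℝ` with
`q(w, Re z) = q(w, Im z) = 0` has `q(w, w) < 0`: `φ⁻¹ w` is a real `(1,1)`-class `q`-orthogonal to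
`N¹(X) ∋ κ`. [cite: Beauville1983, §8 Thm. 5] [cite: VoisinHodgeI2002, §6.3.2 Thm. 6.32]
[cite: Huybrechts2016K3, Ch. 3 Lemma 3.1] -/
theorem qR_self_neg_of_mem_span_ratTransc (hX : IsSmoothProjective 4 X) (hM : MarkedK3Sq[X, φ, P, z])
    (hNQ : ∀ v, v ∈ NQ ↔ φ.symm (fun i => (v i : ℂ)) ∈ algebraicClasses X 1)
    {w : K3HilbertIndex → ℝ}
    (hw : w ∈ Submodule.span ℝ ((fun a : K3HilbertIndex → ℚ => fun i => (a i : ℝ)) ''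
      ((qQ).orthogonal NQ : Set (K3HilbertIndex → ℚ))))
    (h1 : qR w (fun i => (z i).re) = 0) (h2 : qR w (fun i => (z i).im) = 0) (hw0 : w ≠ 0) :
    qR w w < 0 := by
  obtain ⟨-, hint, -, -, h11, -⟩ := id hM
  obtain ⟨D⟩ := nonempty_kaehlerRationalDatum hX
  set c : complexBetti X 2 := φ.symm (fun i => ((w i : ℝ) : ℂ)) with hcdef
  have hφc : φ c = fun i => ((w i : ℝ) : ℂ) := φ.apply_symm_apply _
  -- `c ⊥ N¹(X)`
  have hcT : ∀ d ∈ algebraicClasses X 1, k3HilbertForm 2 (φ c) (φ d) = 0 := by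
    rw [hφc]
    exact (mem_span_ratTransc_iff hX hint hNQ _).1 (realCast_mem_span_ratCast _ hw)
  -- `c` is of type `(1,1)`
  have hcz : k3HilbertForm 2 (φ c) z = 0 := by
    rw [hφc, k3HilbertForm_realCast_period, h1, h2]
    simp
  have hczbar : k3HilbertForm 2 (φ c) (star z) = 0 := by
    rw [hφc, k3HilbertForm_realCast_star_period, h1, h2]
    simp
  have hc11 : IsOfHodgeType 4 X 2 1 1 c := (h11 c).2 ⟨hcz, hczbar⟩
  -- `c` is real and non-zero
  have hstar : star (φ c) = φ c := by
    rw [hφc]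
    funext i
    simp
  have hcreal : conjClass (ComplexPoints X) 2 c = c := by
    apply φ.injective
    rw [marking_conjClass hint, hstar]
  have hc0 : c ≠ 0 := by
    intro h0
    apply hw0
    have h : (fun i => ((w i : ℝ) : ℂ)) = 0 := by rw [← hφc, h0, map_zero]
    funext i
    have hi := congrFun h i
    simp only [Pi.zero_apply, Complex.ofReal_eq_zero] at hi
    exact hi
  -- `κ ⊥ c`
  have hκN : D.Hη ∈ algebraicClasses X 1 :=
    lefschetzOneOne_rational_holds hX D.Hη D.isRationalClass_Hη D.isOfHodgeType_Hη
  have hκc : k3HilbertForm 2 (φ D.Hη) (φ c) = 0 := by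
    rw [k3HilbertForm_comm]
    exact hcT _ hκN
  have h := (k3HilbertForm_self_neg_of_oneOne_of_kaehler_orthogonal hX hM D hc11 hcreal hc0 hκc).1
  rw [hφc, k3HilbertForm_realCast, Complex.ofReal_re] at h
  exact h

/-- **The positive `2`-plane**: `q(Re z, Re z) = q(Im z, Im z) > 0` and `q(Re z, Im z) = 0` (from
`q(z,z) = 0`, `q(z̄, z) > 0`, (m6)). [cite: Huybrechts2016K3, Ch. 6 Prop. 1.2] -/
theorem qR_re_im_period (hM : MarkedK3Sq[X, φ, P, z]) :
    qR (fun i => (z i).re) (fun i => (z i).re) = qR (fun i => (z i).im) (fun i => (z i).im) ∧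
      qR (fun i => (z i).re) (fun i => (z i).im) = 0 ∧
      0 < qR (fun i => (z i).re) (fun i => (z i).re) := by
  obtain ⟨-, -, -, -, -, hzz, hzpos⟩ := id hM
  set a : ℝ := qR (fun i => (z i).re) (fun i => (z i).re) with ha
  set b : ℝ := qR (fun i => (z i).im) (fun i => (z i).im) with hb
  set m : ℝ := qR (fun i => (z i).re) (fun i => (z i).im) with hm
  have hm' : qR (fun i => (z i).im) (fun i => (z i).re) = m := by rw [hm, k3HilbertFormR_comm]
  have e1 : k3HilbertForm 2 (fun i => (((z i).re : ℝ) : ℂ)) z = (a : ℂ) + Complex.I * (m : ℂ) := by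
    rw [k3HilbertForm_realCast_period, ← ha, ← hm]
  have e2 : k3HilbertForm 2 (fun i => (((z i).im : ℝ) : ℂ)) z = (m : ℂ) + Complex.I * (b : ℂ) := by
    rw [k3HilbertForm_realCast_period, hm', ← hb]
  have hI : Complex.I * Complex.I = -1 := Complex.I_mul_I
  -- `q(z, z) = (a - b) + 2 i m`
  have hzz' : k3HilbertForm 2 z z = ((a - b : ℝ) : ℂ) + Complex.I * ((2 * m : ℝ) : ℂ) := by
    conv_lhs => arg 2; rw [period_eq_re_add_im z]
    rw [k3HilbertForm_add_left, k3HilbertForm_smul_left, e1, e2]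
    push_cast
    linear_combination (b : ℂ) * hI
  -- `q(z̄, z) = a + b`
  have hzbz : k3HilbertForm 2 (star z) z = ((a + b : ℝ) : ℂ) := by
    conv_lhs => arg 2; rw [star_period_eq_re_sub_im z]
    rw [sub_eq_add_neg, ← neg_smul, k3HilbertForm_add_left, k3HilbertForm_smul_left, e1, e2]
    push_cast
    linear_combination (-(b : ℂ)) * hI
  rw [hzz'] at hzz
  rw [hzbz, Complex.ofReal_re] at hzpos
  have hre := congrArg Complex.re hzz
  have him := congrArg Complex.im hzz
  simp at hre him
  refine ⟨by linarith, by linarith, by linarith⟩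

end NS

end Summit.HodgeConjecture.HodgeConjecture.Theorems.MarkmanPartnerTransport.PartnerLattice

end
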